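import Literature.MathematicalPhysics.QuantumFieldTheory.Balaban1983to89.Node00.Record13SepLiveSelector

/-!
# Negative ∕ tightness lemmas for K0⁗ `BalabanUVNodes.Record13SepInhabited` (stmt-QuantumFields-20289):
# the run guard `PartCompat₁₃` of row P11 (`Stage13Params.Provisos₁₃Sep.bg`, `Node00/Record13` v1.2 §9) is θ-DODGEABLE

Refuter vetting seat `refuter-ym-vet-20289-g0` (2026-08-27).  `PartCompat₁₃ θ p n` asks, at every scale `1 ≤ j ≤ n`, that the 𝐃_j-cube side
`L^j · θ.τ9.M · R_j` (fine sites) divide the torus period `2·L^(m+K)` (`Params.sitesPerDir 0`).  The K0⁗ body pins the basic cube size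
`θ.τ9.M` only by `1 ≤ M` (`Stage12Numerics.Pos` ∕ Stage-9 admissibility).  Whenever `4 ∣ θ.τ9.M` the side is divisible by `4` while
`2·L^(m+K)` is `≡ 2 (mod 4)` (`L` odd, `T4Family.hL`): NO run of positive length is partition-compatible (`not_partCompat₁₃_of_four_dvd`),
so the separated-range row P11 demands NOTHING on any run of length `≥ 1`, and at length `0` its body `∀ j, 1 ≤ j → j ≤ 0 → …` is empty:
`Provisos₁₃Sep` at such a `θ` IS the bg-free core `Provisos₁₃Core` (`provisos₁₃Sep_of_core_of_four_dvd`) — i.e. any proof of K0⁗ may take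
`M := 4` and never meet [15] Theorem 1 ∕ [III] (2.28).  These are `_false_without_<H>`-type facts for the MISSING SIDE CONDITION
H := «`θ.τ9.M` divides a torus side» (print: [Balaban1988Convergent] p. 257 «all partitions are compatible» presupposes `M R_j L^j ∣ 2L^(m+K)`,
i.e. `M ∈ {L^a, 2L^a}`); they stay true after the repair and record why it is needed.  Small-model facts; nothing of Bałaban asserted.
-/

open scoped Matrix.Norms.L2Operator
open Literature.MathematicalPhysics.QuantumFieldTheory.Balaban1983to89
open Literature.MathematicalPhysics.QuantumFieldTheory.Balaban1983to89.Node00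
open Literature.MathematicalPhysics.QuantumFieldTheory.Balaban1983to89.T4Continuum

namespace Summit.QuantumFields.YangMills.Theorems.BalabanUVNodesRecord13SepInhabited.Negative

variable {F : T4Family} {N : ℕ} [NeZero N]

/-- **No run of positive length is partition-compatible when `4 ∣ M`**: `4 ∣ L^1·M·R₁` but `4 ∤ 2·L^(m+K)` (`L` odd).
[cite: Balaban1988Convergent, (2.1) p.254, p.257 (small-model fact about the tree's `PartCompat₁₃`)] -/
theorem not_partCompat₁₃_of_four_dvd (θ : Stage13Params F N) (h4 : 4 ∣ θ.τ9.M) (p : B12.RunParams) {n : ℕ} (hn : 1 ≤ n) :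
    ¬ PartCompat₁₃ F N θ p n := by
  intro h
  have h1 := h 1 le_rfl hn
  change F.L ^ 1 * θ.τ9.M * _ ∣ 2 * F.L ^ (F.m + p.K - 0) at h1
  have h4' : 4 ∣ 2 * F.L ^ (F.m + p.K - 0) :=
    h4.trans ((Dvd.intro_left _ rfl).trans ((Dvd.intro _ rfl).trans h1))
  obtain ⟨t, ht⟩ := F.hL.1.pow (n := F.m + p.K - 0)
  omega

/-- **Row P11 of `Provisos₁₃Sep` is VACUOUS when `4 ∣ M`**: the separated-range background proviso holds at every level of every run
(length `0`: empty body; length `≥ 1`: the run guard fails). [cite: Balaban1988Convergent, (2.28) p.259, p.257 (small-model fact)] -/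
theorem bgRowSep_of_four_dvd (θ : Stage13Params F N) (h4 : 4 ∣ θ.τ9.M) (p : B12.RunParams) (n : ℕ) (_hn : n ≤ p.K)
    (_hw : Step.InInterval θ.γ n (gOfRecord₁₃ F N θ p)) (hpc : PartCompat₁₃ F N θ p n) :
    BgProvisoΛ F N p.K (settingOfRecord₁₃ F N θ p) (θ.Rz p.K) θ.τ9.M n (suppOfRecord₁₃Sep F N θ p n) (UbgOfRecord₁₃ F N θ p n) :=
  (Stage13Params.bgProvisoΛ_suppSep_iff F N θ p n).2
    fun _ _ _ _ _j h1 hj _ => (not_partCompat₁₃_of_four_dvd θ h4 p (le_trans h1 hj) hpc).elim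

/-- **`Provisos₁₃Sep` at a `θ` with `4 ∣ M` IS the bg-free core**: any supplier of the nine other rows inhabits the displayed provisos
WITHOUT touching [15] Theorem 1 ∕ [III] (2.28) — the missing side condition «`M` divides a torus side» located. [cite: Balaban1988Convergent, (2.18) p.257, (2.28) p.259, p.257 (small-model fact)] -/
theorem provisos₁₃Sep_of_core_of_four_dvd (θ : Stage13Params F N) (h4 : 4 ∣ θ.τ9.M) (hc : θ.Provisos₁₃Core F N) :
    θ.Provisos₁₃Sep F N :=
  θ.provisos₁₃Sep_of_core hc (bgRowSep_of_four_dvd θ h4)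

/-- … and conversely the core is all it carries there (`.toCore`), so at `4 ∣ M` the two are EQUIVALENT. [cite: Balaban1988Convergent, (2.18) p.257 (bookkeeping)] -/
theorem provisos₁₃Sep_iff_core_of_four_dvd (θ : Stage13Params F N) (h4 : 4 ∣ θ.τ9.M) :
    θ.Provisos₁₃Sep F N ↔ θ.Provisos₁₃Core F N :=
  ⟨fun h => h.toCore, provisos₁₃Sep_of_core_of_four_dvd θ h4⟩

end Summit.QuantumFields.YangMills.Theorems.BalabanUVNodesRecord13SepInhabited.Negative
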